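import Summits.Ventures.PercRepro.C026HubAttachC

/-!
# Hub attachment and the D-free inequality, IV: the event `a ~_H b` through the hubs (p5, gen 10)

With the projection `hConnAvoid_iff_aug` (`C026HubAttachB.lean`) the three events of the D-free
inequality for a `bot` configuration `ω` are read off the base `β = baseOf Hs ω` and the signature
bits (`SigA := SigM a`, `SigB := SigM b`, `SigLink`):

* a generic lemma on reflexive–transitive closures with virtual edges among three terminals
  (**`rtg_sup_terminal_iff`**: `a` and `b` are joined iff the terminal triangle joins them);
* **`hConn_ab_iff`** — `a ~_H b` in `ω` iff `a ~_H b` in `β`, or a link, or (`c ~_H a` in `β` or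
  `SigA`) and (`c ~_H b` in `β` or `SigB`);
* the two offers `hConnAvoid_ca_iff` / `hConnAvoid_cb_iff` are in `C026HubAttachE.lean`.
-/

namespace PercRepro

/-! ### Reflexive–transitive closure with virtual edges among three terminals -/

section Terminal

variable {α : Type*} {S Vr : α → α → Prop} {a b c : α}

/-- Monotonicity of the reflexive–transitive closure. -/
theorem rtg_mono {R R' : α → α → Prop} (h : ∀ u v, R u v → R' u v) {x y : α}
    (hr : Relation.ReflTransGen R x y) : Relation.ReflTransGen R' x y := by
  induction hr with
  | refl => exact Relation.ReflTransGen.refl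
  | tail _ hs ih => exact ih.tail (h _ _ hs)

/-- The reflexive–transitive closure of a symmetric relation is symmetric. -/
theorem rtg_symm {R : α → α → Prop} (h : ∀ u v, R u v → R v u) {x y : α}
    (hr : Relation.ReflTransGen R x y) : Relation.ReflTransGen R y x := by
  induction hr with
  | refl => exact Relation.ReflTransGen.refl
  | tail _ hs ih => exact (Relation.ReflTransGen.single (h _ _ hs)).trans ih

/-- Two reflexive–transitive closures of pointwise-equivalent relations agree. -/
theorem rtg_congr {R R' : α → α → Prop} (h : ∀ u v, R u v ↔ R' u v) {x y : α} :
    Relation.ReflTransGen R x y ↔ Relation.ReflTransGen R' x y :=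
  ⟨rtg_mono (fun u v => (h u v).1), rtg_mono (fun u v => (h u v).2)⟩

/-- A walk in `S ⊔ Vr` starting at `a`: its end is `S`-reachable from a terminal reachable from `a`
in the terminal triangle. -/
theorem rtg_sup_terminal_imp (hS : ∀ u v, S u v → S v u) (hVr : ∀ u v, Vr u v → Vr v u)
    (hsupp : ∀ u v, Vr u v → (u = a ∨ u = b ∨ u = c) ∧ (v = a ∨ v = b ∨ v = c)) {z : α}
    (h : Relation.ReflTransGen (fun u v => S u v ∨ Vr u v) a z) :
    ∃ t, (t = a ∨
      (t = c ∧ ((Relation.ReflTransGen S a c ∨ Vr a c) ∨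
        ((Relation.ReflTransGen S a b ∨ Vr a b) ∧ (Relation.ReflTransGen S b c ∨ Vr b c)))) ∨
      (t = b ∧ ((Relation.ReflTransGen S a b ∨ Vr a b) ∨
        ((Relation.ReflTransGen S a c ∨ Vr a c) ∧ (Relation.ReflTransGen S b c ∨ Vr b c))))) ∧
      Relation.ReflTransGen S t z := by
  have hSsymm : ∀ u v, Relation.ReflTransGen S u v → Relation.ReflTransGen S v u :=
    fun u v h => rtg_symm hS h
  -- the terminal triangle
  let E : α → α → Prop := fun u v => Relation.ReflTransGen S u v ∨ Vr u v
  have hE : ∀ u v, E u v → E v u := fun u v h => h.elim (fun h => Or.inl (hSsymm u v h))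
    (fun h => Or.inr (hVr u v h))
  let Reach : α → Prop := fun t => t = a ∨ (t = c ∧ (E a c ∨ (E a b ∧ E b c))) ∨
    (t = b ∧ (E a b ∨ (E a c ∧ E b c)))
  have hclosed : ∀ t z, Reach t → (z = a ∨ z = b ∨ z = c) → E t z → Reach z := by
    intro t z ht hz htz
    rcases ht with rfl | ⟨rfl, hc⟩ | ⟨rfl, hb⟩ <;> rcases hz with rfl | rfl | rfl
    · exact Or.inl rfl
    · exact Or.inr (Or.inr ⟨rfl, Or.inl htz⟩)
    · exact Or.inr (Or.inl ⟨rfl, Or.inl htz⟩)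
    · exact Or.inl rfl
    · exact Or.inr (Or.inr ⟨rfl, hc.elim (fun h1 => Or.inr ⟨h1, hE _ _ htz⟩) (fun h1 => Or.inl h1.1)⟩)
    · exact Or.inr (Or.inl ⟨rfl, hc⟩)
    · exact Or.inl rfl
    · exact Or.inr (Or.inr ⟨rfl, hb⟩)
    · exact Or.inr (Or.inl ⟨rfl, hb.elim (fun h1 => Or.inr ⟨h1, htz⟩) (fun h1 => Or.inl h1.1)⟩)
  induction h with
  | refl => exact ⟨a, Or.inl rfl, Relation.ReflTransGen.refl⟩
  | @tail z z' _ hstep ih =>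
    obtain ⟨t, ht, htz⟩ := ih
    rcases hstep with hs | hv
    · exact ⟨t, ht, htz.tail hs⟩
    · obtain ⟨hzT, hz'T⟩ := hsupp z z' hv
      have hz : Reach z := hclosed t z ht hzT (Or.inl htz)
      have hz' : Reach z' := hclosed z z' hz hz'T (Or.inr hv)
      exact ⟨z', hz', Relation.ReflTransGen.refl⟩

/-- **Reachability with virtual edges among three terminals**: `a` and `b` are joined in `S ⊔ Vr`
iff they are joined directly, or both are joined to `c`. -/
theorem rtg_sup_terminal_iff (hS : ∀ u v, S u v → S v u) (hVr : ∀ u v, Vr u v → Vr v u)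
    (hsupp : ∀ u v, Vr u v → (u = a ∨ u = b ∨ u = c) ∧ (v = a ∨ v = b ∨ v = c)) :
    Relation.ReflTransGen (fun u v => S u v ∨ Vr u v) a b ↔
      (Relation.ReflTransGen S a b ∨ Vr a b) ∨
        ((Relation.ReflTransGen S a c ∨ Vr a c) ∧ (Relation.ReflTransGen S b c ∨ Vr b c)) := by
  have hSsymm : ∀ u v, Relation.ReflTransGen S u v → Relation.ReflTransGen S v u :=
    fun u v h => rtg_symm hS h
  have hmono : ∀ u v, Relation.ReflTransGen S u v →
      Relation.ReflTransGen (fun u v => S u v ∨ Vr u v) u v :=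
    fun u v h => rtg_mono (fun _ _ h => Or.inl h) h
  have hsym2 : ∀ u v, Relation.ReflTransGen (fun u v => S u v ∨ Vr u v) u v →
      Relation.ReflTransGen (fun u v => S u v ∨ Vr u v) v u := fun u v h =>
    rtg_symm (fun u v h => h.elim (fun h => Or.inl (hS u v h)) (fun h => Or.inr (hVr u v h))) h
  have hE : ∀ u v, (Relation.ReflTransGen S u v ∨ Vr u v) →
      Relation.ReflTransGen (fun u v => S u v ∨ Vr u v) u v := fun u v h =>
    h.elim (hmono u v) (fun h => Relation.ReflTransGen.single (Or.inr h))
  constructor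
  · intro h
    obtain ⟨t, ht, htb⟩ := rtg_sup_terminal_imp hS hVr hsupp h
    rcases ht with rfl | ⟨htc, hc⟩ | ⟨-, hb⟩
    · exact Or.inl (Or.inl htb)
    · rw [htc] at htb
      have hbc : Relation.ReflTransGen S b c ∨ Vr b c := Or.inl (hSsymm _ _ htb)
      rcases hc with h1 | ⟨h1, -⟩
      · exact Or.inr ⟨h1, hbc⟩
      · exact Or.inl h1
    · exact hb
  · rintro (h | ⟨h1, h2⟩)
    · exact hE a b h
    · exact (hE a c h1).trans (hsym2 _ _ (hE b c h2))

end Terminal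

namespace MultiGraph

variable {V E : Type*} {G : MultiGraph V E}

section Events

variable {Hs : Set V}

/-- H-walks avoiding nothing are H-walks. -/
theorem hConnAvoid_empty_iff (S : Config E) (c u v : V) :
    G.HConnAvoid S c (∅ : Set V) u v ↔ G.HConn S c u v := by
  constructor
  · intro h
    exact rtg_mono (fun _ _ h => h.1) h
  · intro h
    exact rtg_mono (fun _ _ h => ⟨h, fun h' => h', fun h' => h'⟩) h

/-- A cluster is a union of clusters. -/
theorem cluster_closed (S : Config E) (m : V) : ∀ u v, G.Conn S u v →
    (u ∈ G.cluster S m ↔ v ∈ G.cluster S m) := fun u v h =>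
  ⟨fun hu => (hu : G.Conn S m u).trans h, fun hv => (hv : G.Conn S m v).trans h.symm⟩

/-- The empty set is a union of clusters. -/
theorem empty_closed (S : Config E) : ∀ u v, G.Conn S u v → (u ∈ (∅ : Set V) ↔ v ∈ (∅ : Set V)) :=
  fun _ _ _ => Iff.rfl

/-- The base has no open hub edge. -/
theorem not_openTo_base {h : V} (hh : h ∈ Hs) (ω : Config E) (y : V) :
    ¬ G.OpenTo (G.baseOf Hs ω) h y := by
  rintro ⟨e, he, hl⟩
  have : e ∈ G.edgesAt Hs := (hl.mem_edgesAt_iff Hs).2 (Or.inl hh)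
  rw [baseOf_apply_of_mem ω this] at he
  exact Bool.noConfusion he

/-- No signature bit of the base. -/
theorem not_sigM_base (X : Set V) (ω : Config E) (m c : V) : ¬ G.SigM Hs X (G.baseOf Hs ω) m c := by
  rintro ⟨h, hh, -, ⟨ho, -⟩ | ⟨ho, -⟩⟩
  · exact not_openTo_base hh ω m ho
  · exact not_openTo_base hh ω c ho

/-- No link in the base. -/
theorem not_sigLink_base (X : Set V) (ω : Config E) (a b c : V) :
    ¬ G.SigLink Hs X (G.baseOf Hs ω) a b c := by
  rintro ⟨h, hh, -, ho, -⟩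
  exact not_openTo_base hh ω c ho

end Events

/-! ### The three events through the hubs -/

section Three

variable {Hs : Set V} {a b c : V} {ω : Config E}

/-- The marks of a `bot` configuration are distinct. -/
theorem IsBot.ne_ab (hbot : G.IsBot ω a b c) : a ≠ b := fun h => hbot.1 (h ▸ Conn.refl G ω a)

/-- The marks of a `bot` configuration are distinct. -/
theorem IsBot.ne_ac (hbot : G.IsBot ω a b c) : a ≠ c := fun h => hbot.2.1 (h ▸ Conn.refl G ω a)

/-- The marks of a `bot` configuration are distinct. -/
theorem IsBot.ne_bc (hbot : G.IsBot ω a b c) : b ≠ c := fun h => hbot.2.2 (h ▸ Conn.refl G ω b)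

/-- `IsMark` is symmetric in `a, b`. -/
theorem isMark_swap {x : V} (h : IsMark a b c x) : IsMark b a c x := by
  rcases h with h | h | h
  · exact Or.inr (Or.inl h)
  · exact Or.inl h
  · exact Or.inr (Or.inr h)

/-- `IsHubLike` is symmetric in `a, b`. -/
theorem IsHubLike.swap {x : V} (h : G.IsHubLike a b c x) : G.IsHubLike b a c x := fun f =>
  ⟨fun hf => isMark_swap ((h f).1 hf), fun hf => isMark_swap ((h f).2 hf)⟩

/-- A hub set for `(a, b, c)` is a hub set for `(b, a, c)`. -/
theorem IsHubSet.swap (hH : G.IsHubSet Hs a b c) : G.IsHubSet Hs b a c := fun h hh =>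
  ⟨(hH h hh).1.swap, (hH h hh).2.2.1, (hH h hh).2.1, (hH h hh).2.2.2⟩

/-- A walk whose steps end outside `L` and starts at `c ∉ L` ends outside `L` unless it is trivial. -/
theorem rtg_notMem_of_steps {R : V → V → Prop} {L : Set V} (hR : ∀ u v, R u v → v ∉ L) {x y : V}
    (h : Relation.ReflTransGen R x y) (hxy : x ≠ y) : y ∉ L := by
  induction h with
  | refl => exact (hxy rfl).elim
  | tail _ hs _ => exact hR _ _ hs

variable (hH : G.IsHubSet Hs a b c) (hbot : G.IsBot ω a b c)
include hH hbot

/-- The base steps of the augmented relation of the base are the base steps. -/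
theorem IsHubSet.hConnAvoid_base_iff (X : Set V) (hXc : c ∉ X)
    (hXcl : ∀ u v, G.Conn (G.baseOf Hs ω) u v → (u ∈ X ↔ v ∈ X)) {x y : V} (hx : x ∉ Hs)
    (hy : y ∉ Hs) :
    G.HConnAvoid (G.baseOf Hs ω) c X x y ↔
      Relation.ReflTransGen (fun u v => u ∉ Hs ∧ v ∉ Hs ∧ u ∉ X ∧ v ∉ X ∧
        G.HAdj (G.baseOf Hs ω) c u v) x y := by
  have hbotβ : G.IsBot (G.baseOf Hs ω) a b c := ((hH.isBot_iff_base ω).1 hbot).1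
  rw [hH.hConnAvoid_iff_aug hbotβ hXc hXcl hx hy]
  refine rtg_congr fun u v => ?_
  unfold AugAdj
  rw [baseOf_baseOf]
  constructor
  · rintro (h | ⟨-, -, ⟨hs, -⟩ | ⟨hs, -⟩ | ⟨hs, -⟩⟩)
    · exact h
    · exact (not_sigM_base X ω a c hs).elim
    · exact (not_sigM_base X ω b c hs).elim
    · exact (not_sigLink_base X ω a b c hs).elim
  · intro h
    exact Or.inl h

/-- **`a ~_H b` through the hubs**: in `ω`, `a ~_H b` iff `a ~_H b` in the base, or a link, or
(`c ~_H a` in the base or `SigA`) and (`c ~_H b` in the base or `SigB`). -/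
theorem IsHubSet.hConn_ab_iff :
    G.HConn ω c a b ↔
      (G.HConn (G.baseOf Hs ω) c a b ∨ G.SigLink Hs ∅ ω a b c) ∨
        ((G.HConn (G.baseOf Hs ω) c a c ∨ G.SigM Hs ∅ ω a c) ∧
          (G.HConn (G.baseOf Hs ω) c b c ∨ G.SigM Hs ∅ ω b c)) := by
  have hab := hbot.ne_ab
  have hac := hbot.ne_ac
  have hbc := hbot.ne_bc
  have ha : a ∉ Hs := hH.mark_notMem (Or.inl rfl)
  have hb : b ∉ Hs := hH.mark_notMem (Or.inr (Or.inl rfl))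
  have hc : c ∉ Hs := hH.mark_notMem (Or.inr (Or.inr rfl))
  set β := G.baseOf Hs ω with hβ
  -- the two relations
  let S : V → V → Prop := fun u v => u ∉ Hs ∧ v ∉ Hs ∧ G.HAdj β c u v
  let Vr : V → V → Prop := fun u v =>
    (G.SigM Hs ∅ ω a c ∧ ((u = c ∧ v = a) ∨ (u = a ∧ v = c))) ∨
      (G.SigM Hs ∅ ω b c ∧ ((u = c ∧ v = b) ∨ (u = b ∧ v = c))) ∨
        (G.SigLink Hs ∅ ω a b c ∧ ((u = a ∧ v = b) ∨ (u = b ∧ v = a)))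
  have hS : ∀ u v, S u v → S v u := fun u v ⟨hu, hv, h⟩ => ⟨hv, hu, G.hAdj_symm h⟩
  have hVr : ∀ u v, Vr u v → Vr v u := by
    intro u v h
    have sw : ∀ {p q r s : Prop}, (p ∧ q) ∨ (r ∧ s) → (s ∧ r) ∨ (q ∧ p) := fun h =>
      h.elim (fun ⟨h1, h2⟩ => Or.inr ⟨h2, h1⟩) (fun ⟨h1, h2⟩ => Or.inl ⟨h2, h1⟩)
    rcases h with ⟨hs, h⟩ | ⟨hs, h⟩ | ⟨hs, h⟩
    · exact Or.inl ⟨hs, sw h⟩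
    · exact Or.inr (Or.inl ⟨hs, sw h⟩)
    · exact Or.inr (Or.inr ⟨hs, sw h⟩)
  have hsupp : ∀ u v, Vr u v → (u = a ∨ u = b ∨ u = c) ∧ (v = a ∨ v = b ∨ v = c) := by
    rintro u v (⟨-, ⟨rfl, rfl⟩ | ⟨rfl, rfl⟩⟩ | ⟨-, ⟨rfl, rfl⟩ | ⟨rfl, rfl⟩⟩ | ⟨-, ⟨rfl, rfl⟩ | ⟨rfl, rfl⟩⟩)
    · exact ⟨Or.inr (Or.inr rfl), Or.inl rfl⟩
    · exact ⟨Or.inl rfl, Or.inr (Or.inr rfl)⟩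
    · exact ⟨Or.inr (Or.inr rfl), Or.inr (Or.inl rfl)⟩
    · exact ⟨Or.inr (Or.inl rfl), Or.inr (Or.inr rfl)⟩
    · exact ⟨Or.inl rfl, Or.inr (Or.inl rfl)⟩
    · exact ⟨Or.inr (Or.inl rfl), Or.inl rfl⟩
  -- the augmented relation with `X = ∅` is `S ⊔ Vr`
  have haug : ∀ u v, G.AugAdj Hs ∅ ω a b c u v ↔ (S u v ∨ Vr u v) := by
    intro u v
    constructor
    · rintro (⟨hu, hv, -, -, h⟩ | ⟨-, -, h⟩)
      · exact Or.inl ⟨hu, hv, h⟩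
      · exact Or.inr h
    · rintro (⟨hu, hv, h⟩ | h)
      · exact Or.inl ⟨hu, hv, fun h => h, fun h => h, h⟩
      · exact Or.inr ⟨fun h => h, fun h => h, h⟩
  have hbase : ∀ u v, (u ∉ Hs ∧ v ∉ Hs ∧ u ∉ (∅ : Set V) ∧ v ∉ (∅ : Set V) ∧ G.HAdj β c u v) ↔
      S u v := fun u v =>
    ⟨fun ⟨hu, hv, _, _, h⟩ => ⟨hu, hv, h⟩, fun ⟨hu, hv, h⟩ => ⟨hu, hv, fun h => h, fun h => h, h⟩⟩
  -- the base events
  have hSab : Relation.ReflTransGen S a b ↔ G.HConn β c a b := by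
    rw [← hConnAvoid_empty_iff, hH.hConnAvoid_base_iff hbot ∅ (fun h => h) (empty_closed β) ha hb]
    exact (rtg_congr hbase).symm
  have hSac : Relation.ReflTransGen S a c ↔ G.HConn β c a c := by
    rw [← hConnAvoid_empty_iff, hH.hConnAvoid_base_iff hbot ∅ (fun h => h) (empty_closed β) ha hc]
    exact (rtg_congr hbase).symm
  have hSbc : Relation.ReflTransGen S b c ↔ G.HConn β c b c := by
    rw [← hConnAvoid_empty_iff, hH.hConnAvoid_base_iff hbot ∅ (fun h => h) (empty_closed β) hb hc]
    exact (rtg_congr hbase).symm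
  -- the virtual edges
  have hVab : Vr a b ↔ G.SigLink Hs ∅ ω a b c := by
    constructor
    · rintro (⟨-, ⟨h1, -⟩ | ⟨-, h2⟩⟩ | ⟨-, ⟨h1, -⟩ | ⟨h1, -⟩⟩ | ⟨hs, -⟩)
      · exact (hac h1).elim
      · exact (hbc h2).elim
      · exact (hac h1).elim
      · exact (hab h1).elim
      · exact hs
    · intro hs
      exact Or.inr (Or.inr ⟨hs, Or.inl ⟨rfl, rfl⟩⟩)
  have hVac : Vr a c ↔ G.SigM Hs ∅ ω a c := by
    constructor
    · rintro (⟨hs, -⟩ | ⟨-, ⟨h1, -⟩ | ⟨h1, -⟩⟩ | ⟨-, ⟨-, h2⟩ | ⟨h1, -⟩⟩)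
      · exact hs
      · exact (hac h1).elim
      · exact (hab h1).elim
      · exact (hbc h2.symm).elim
      · exact (hab h1).elim
    · intro hs
      exact Or.inl ⟨hs, Or.inr ⟨rfl, rfl⟩⟩
  have hVbc : Vr b c ↔ G.SigM Hs ∅ ω b c := by
    constructor
    · rintro (⟨-, ⟨h1, -⟩ | ⟨h1, -⟩⟩ | ⟨hs, -⟩ | ⟨-, ⟨h1, -⟩ | ⟨-, h2⟩⟩)
      · exact (hbc h1).elim
      · exact (hab h1.symm).elim
      · exact hs
      · exact (hab h1.symm).elim
      · exact (hac h2.symm).elim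
    · intro hs
      exact Or.inr (Or.inl ⟨hs, Or.inr ⟨rfl, rfl⟩⟩)
  rw [← hConnAvoid_empty_iff, hH.hConnAvoid_iff_aug hbot (X := ∅) (fun h => h) (empty_closed ω) ha hb,
    rtg_congr haug, rtg_sup_terminal_iff hS hVr hsupp, hSab, hSac, hSbc, hVab, hVac, hVbc]

end Three

end MultiGraph

end PercRepro
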